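import Literature.NumberTheory.LFunctions.NumberFieldDirichletDensity
import HarnessLib

/-!
# Calculus of Dirichlet densities of sets of primes of a number field (Neukirch VII (13.1))

Topic `Literature/NumberTheory/LFunctions`; namespace
`Literature.NumberTheory.LFunctions.NumberField`.  Everything in this file is PROVED (theorems
only; no definition, no named fact).  It supplies the
elementary bookkeeping for Neukirch's notion of Dirichlet density
`Literature.NumberTheory.LFunctions.NumberField.HasDirichletDensity K P d`
(`NumberFieldDirichletDensity.lean`: `(Σ_{v ∈ P} 𝔑v^{-s}) / (Σ_v 𝔑v^{-s}) → d` as `s → 1⁺`) that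
Neukirch uses silently in VII §13 (e.g. in (13.6): "the sets `P_{L|K}(σ)` … are disjoint … so the
density is `Σ #⟨σ⟩/#G`") and that the weak-divisibility arguments of Böckle–Hui 2025 (Prop. 2.4,
Lemma 2.8) use in the form "a set of density one meets every set of positive density":

* `HasDirichletDensity.nonneg`, `HasDirichletDensity.le_one` — `0 ≤ d ≤ 1`;
* `HasDirichletDensity.union` (disjoint additivity), `HasDirichletDensity.compl`
  (`d(Pᶜ) = 1 - d(P)`), `HasDirichletDensity.mono_zero` (subsets of density-zero sets),
  `hasDirichletDensity_one_of_cofinite`, `hasDirichletDensity_zero_of_finite`,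
  `HasDirichletDensity.diff_of_finite`;
* **`HasDirichletDensity.inter_of_one`** — if `d(𝓛) = 1` and `d(T) = c` then `d(𝓛 ∩ T) = c`;
* `HasDirichletDensity.infinite_of_pos` — a set of positive density is infinite; hence
  **`HasDirichletDensity.infinite_inter_of_one_of_pos`** — a set of density one meets every set of
  positive density in infinitely many places.

## References

* J. Neukirch, *Algebraic Number Theory* (1999), Ch. VII §13, (13.1)–(13.6). [NeukirchANT1999]
* G. Böckle, C.-Y. Hui, Math. Ann. 393 (2025), §2.6 (densities of the sets `S_{ψ∣ρ}`).
  [BockleHui2025]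
-/

noncomputable section

open Filter IsDedekindDomain
open scoped NumberField Topology Classical

namespace Literature.NumberTheory.LFunctions

namespace NumberField

variable {K : Type*} [Field K] [NumberField K]

/-! ### The sums `Σ_{v ∈ X} 𝔑v^{-s}` -/

/-- There is a nonzero prime of `𝓞 K` (`𝓞 K` is not a field). [folklore] -/
theorem nonempty_heightOneSpectrum (K : Type*) [Field K] [NumberField K] :
    Nonempty (HeightOneSpectrum (𝓞 K)) := by
  obtain ⟨M, hM⟩ := Ideal.exists_maximal (𝓞 K)
  exact ⟨⟨M, hM.isPrime, Ring.ne_bot_of_isMaximal_of_not_isField hM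
    (_root_.NumberField.RingOfIntegers.not_isField K)⟩⟩

/-- `0 ≤ Σ_{v ∈ X} 𝔑v^{-s}`. [folklore] -/
theorem tsum_indicator_nonneg (X : Set (HeightOneSpectrum (𝓞 K))) (s : ℝ) :
    0 ≤ ∑' v : HeightOneSpectrum (𝓞 K),
      (if v ∈ X then (Ideal.absNorm v.asIdeal : ℝ) ^ (-s) else 0) :=
  tsum_nonneg fun v => by
    split_ifs
    · exact absNorm_rpow_neg_nonneg v s
    · exact le_rfl

/-- `Σ_{v ∈ X} 𝔑v^{-s} ≤ Σ_{v ∈ Y} 𝔑v^{-s}` for `X ⊆ Y`, `s > 1`. [folklore] -/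
theorem tsum_indicator_mono {X Y : Set (HeightOneSpectrum (𝓞 K))} (hXY : X ⊆ Y) {s : ℝ}
    (hs : 1 < s) :
    (∑' v : HeightOneSpectrum (𝓞 K),
        (if v ∈ X then (Ideal.absNorm v.asIdeal : ℝ) ^ (-s) else 0)) ≤
      ∑' v : HeightOneSpectrum (𝓞 K),
        (if v ∈ Y then (Ideal.absNorm v.asIdeal : ℝ) ^ (-s) else 0) := by
  refine (summable_indicator_absNorm_rpow_neg (· ∈ X) hs).tsum_le_tsum (fun v => ?_)
    (summable_indicator_absNorm_rpow_neg (· ∈ Y) hs)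
  by_cases hvX : v ∈ X
  · rw [if_pos hvX, if_pos (hXY hvX)]
  · rw [if_neg hvX]
    split_ifs
    · exact absNorm_rpow_neg_nonneg v s
    · exact le_rfl

/-- `Σ_{v ∈ X} 𝔑v^{-s} ≤ Σ_v 𝔑v^{-s}` for `s > 1`. [folklore] -/
theorem tsum_indicator_le_tsum (X : Set (HeightOneSpectrum (𝓞 K))) {s : ℝ} (hs : 1 < s) :
    (∑' v : HeightOneSpectrum (𝓞 K), (if v ∈ X then (Ideal.absNorm v.asIdeal : ℝ) ^ (-s) else 0)) ≤
      ∑' v : HeightOneSpectrum (𝓞 K), (Ideal.absNorm v.asIdeal : ℝ) ^ (-s) := by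
  have h := tsum_indicator_mono (Set.subset_univ X) hs
  simpa only [Set.mem_univ, if_true] using h

/-- `0 < Σ_v 𝔑v^{-s}` for `s > 1`. [folklore] -/
theorem tsum_absNorm_rpow_neg_pos {s : ℝ} (hs : 1 < s) :
    0 < ∑' v : HeightOneSpectrum (𝓞 K), (Ideal.absNorm v.asIdeal : ℝ) ^ (-s) := by
  obtain ⟨v₀⟩ := nonempty_heightOneSpectrum K
  exact (summable_absNorm_rpow_neg hs).tsum_pos (fun v => absNorm_rpow_neg_nonneg v s) v₀
    (Real.rpow_pos_of_pos (lt_trans zero_lt_one (one_lt_absNorm v₀)) _)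

/-- **Additivity**: for disjoint `P`, `T`, `X = P ∪ T` and `s > 1`,
`Σ_{v ∈ X} 𝔑v^{-s} = Σ_{v ∈ P} 𝔑v^{-s} + Σ_{v ∈ T} 𝔑v^{-s}` (the set `X` is a variable with an
equation so that the `if`s carry the same (classical) decidability instances as in
`HasDirichletDensity`). [folklore] -/
theorem tsum_indicator_union {P T X : Set (HeightOneSpectrum (𝓞 K))} (hX : X = P ∪ T)
    (hPT : Disjoint P T) {s : ℝ} (hs : 1 < s) :
    (∑' v : HeightOneSpectrum (𝓞 K),
        (if v ∈ X then (Ideal.absNorm v.asIdeal : ℝ) ^ (-s) else 0)) =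
      (∑' v : HeightOneSpectrum (𝓞 K),
          (if v ∈ P then (Ideal.absNorm v.asIdeal : ℝ) ^ (-s) else 0)) +
        ∑' v : HeightOneSpectrum (𝓞 K),
          (if v ∈ T then (Ideal.absNorm v.asIdeal : ℝ) ^ (-s) else 0) := by
  rw [← (summable_indicator_absNorm_rpow_neg (· ∈ P) hs).tsum_add
    (summable_indicator_absNorm_rpow_neg (· ∈ T) hs)]
  refine tsum_congr fun v => ?_
  subst hX
  by_cases hP : v ∈ P
  · have hT : v ∉ T := Set.disjoint_left.mp hPT hP
    simp [hP, hT]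
  · by_cases hT : v ∈ T
    · simp [hP, hT]
    · simp [hP, hT]

/-! ### `0 ≤ d ≤ 1`, additivity, complements -/

/-- A Dirichlet density is `≥ 0`. [folklore] -/
theorem HasDirichletDensity.nonneg {P : Set (HeightOneSpectrum (𝓞 K))} {d : ℝ}
    (h : HasDirichletDensity K P d) : 0 ≤ d :=
  ge_of_tendsto' h fun s =>
    div_nonneg (tsum_indicator_nonneg P s) (tsum_nonneg fun v => absNorm_rpow_neg_nonneg v s)

/-- A Dirichlet density is `≤ 1` ("`0 ≤ d(M) ≤ 1`", Neukirch VII (13.1)).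
[cite: NeukirchANT1999, Ch. VII (13.1)] -/
theorem HasDirichletDensity.le_one {P : Set (HeightOneSpectrum (𝓞 K))} {d : ℝ}
    (h : HasDirichletDensity K P d) : d ≤ 1 := by
  refine le_of_tendsto h (Filter.eventually_of_mem self_mem_nhdsWithin fun s hs => ?_)
  exact div_le_one_of_le₀ (tsum_indicator_le_tsum P hs)
    (tsum_nonneg fun v => absNorm_rpow_neg_nonneg v s)

/-- **Disjoint additivity of Dirichlet densities** (used in Neukirch VII (13.6)).
[cite: NeukirchANT1999, Ch. VII (13.6) (proof)] -/
theorem HasDirichletDensity.union {P T : Set (HeightOneSpectrum (𝓞 K))} {a b : ℝ}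
    (hPT : Disjoint P T) (hP : HasDirichletDensity K P a) (hT : HasDirichletDensity K T b) :
    HasDirichletDensity K (P ∪ T) (a + b) := by
  refine (hP.add hT).congr' (Filter.eventually_of_mem self_mem_nhdsWithin fun s hs => ?_)
  simp only
  rw [tsum_indicator_union (X := P ∪ T) rfl hPT hs, add_div]

/-- The whole set of primes has density `1`, directly from the definition (the ratio is `1` for
`s > 1`). [folklore] -/
theorem hasDirichletDensity_univ' : HasDirichletDensity K Set.univ 1 := by
  refine (tendsto_const_nhds (x := (1 : ℝ))).congr'
    (Filter.eventually_of_mem self_mem_nhdsWithin fun s hs => ?_)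
  simp only [Set.mem_univ, if_true]
  rw [div_self (tsum_absNorm_rpow_neg_pos hs).ne']

/-- **Complements**: `d(Pᶜ) = 1 - d(P)`. [folklore] -/
theorem HasDirichletDensity.compl {P : Set (HeightOneSpectrum (𝓞 K))} {d : ℝ}
    (h : HasDirichletDensity K P d) : HasDirichletDensity K Pᶜ (1 - d) := by
  refine ((tendsto_const_nhds (x := (1 : ℝ))).sub h).congr'
    (Filter.eventually_of_mem self_mem_nhdsWithin fun s hs => ?_)
  have hN := (tsum_absNorm_rpow_neg_pos (K := K) hs).ne'
  have hsplit := tsum_indicator_union (P := P) (T := Pᶜ) (X := Set.univ)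
    (Set.union_compl_self P).symm disjoint_compl_right hs
  simp only [Set.mem_univ, if_true] at hsplit
  simp only
  rw [eq_div_iff hN, sub_mul, one_mul, div_mul_cancel₀ _ hN, hsplit, add_sub_cancel_left]

/-- A set determines its density: congruent sets have the same density. [folklore] -/
theorem HasDirichletDensity.congr_set {P Q : Set (HeightOneSpectrum (𝓞 K))} {d : ℝ}
    (h : HasDirichletDensity K P d) (hPQ : P = Q) : HasDirichletDensity K Q d := hPQ ▸ h

/-- **Subsets of density-zero sets have density zero** (squeeze). [folklore] -/
theorem HasDirichletDensity.mono_zero {P T : Set (HeightOneSpectrum (𝓞 K))} (hTP : T ⊆ P)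
    (hP : HasDirichletDensity K P 0) : HasDirichletDensity K T 0 := by
  refine tendsto_of_tendsto_of_tendsto_of_le_of_le' tendsto_const_nhds hP
    (Filter.Eventually.of_forall fun s => div_nonneg (tsum_indicator_nonneg T s)
      (tsum_nonneg fun v => absNorm_rpow_neg_nonneg v s))
    (Filter.eventually_of_mem self_mem_nhdsWithin fun s hs => ?_)
  exact div_le_div_of_nonneg_right (tsum_indicator_mono hTP hs)
    (tsum_nonneg fun v => absNorm_rpow_neg_nonneg v s)

/-- **Cofinite sets have density one** (the set of all primes has strong density `1`,
`hasStrongDirichletDensity_univ`, finitely many exceptions do not matter,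
`HasStrongDirichletDensity.of_finite_symmDiff`, and strong density implies Neukirch's density).
Ref: Neukirch VII (13.1)–(13.2). [folklore] -/
theorem hasDirichletDensity_one_of_cofinite {P : Set (HeightOneSpectrum (𝓞 K))} (hP : Pᶜ.Finite) :
    HasDirichletDensity K P 1 := by
  have hs : HasStrongDirichletDensity K P 1 :=
    (hasStrongDirichletDensity_univ K).of_finite_symmDiff hP fun q hq => by
      simp only [Set.mem_compl_iff, not_not] at hq
      exact ⟨fun _ => hq, fun _ => Set.mem_univ q⟩
  exact hs.numberField_hasDirichletDensity

/-- **Finite sets have density zero.** [folklore] -/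
theorem hasDirichletDensity_zero_of_finite {F : Set (HeightOneSpectrum (𝓞 K))} (hF : F.Finite) :
    HasDirichletDensity K F 0 := by
  have h := (hasDirichletDensity_one_of_cofinite (P := Fᶜ) (by rwa [compl_compl])).compl
  rw [compl_compl, sub_self] at h
  exact h

/-- **A density-one set meets every set in full density**: if `d(𝓛) = 1` and `d(T) = c` then
`d(𝓛 ∩ T) = c` (`T = (T ∩ 𝓛) ⊔ (T ∩ 𝓛ᶜ)` and `d(T ∩ 𝓛ᶜ) ≤ d(𝓛ᶜ) = 0`). [folklore] -/
theorem HasDirichletDensity.inter_of_one {𝓛 T : Set (HeightOneSpectrum (𝓞 K))} {c : ℝ}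
    (h𝓛 : HasDirichletDensity K 𝓛 1) (hT : HasDirichletDensity K T c) :
    HasDirichletDensity K (𝓛 ∩ T) c := by
  have h0 : HasDirichletDensity K (T ∩ 𝓛ᶜ) 0 := by
    have := h𝓛.compl
    rw [sub_self] at this
    exact this.mono_zero Set.inter_subset_right
  -- `ratio (𝓛 ∩ T) = ratio T - ratio (T ∩ 𝓛ᶜ)` for `s > 1`
  have hdisj : Disjoint (𝓛 ∩ T) (T ∩ 𝓛ᶜ) := by
    rw [Set.disjoint_left]
    rintro v ⟨hv𝓛, -⟩ ⟨-, hvc⟩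
    exact hvc hv𝓛
  have hunion : (𝓛 ∩ T) ∪ (T ∩ 𝓛ᶜ) = T := by
    ext v
    constructor
    · rintro (⟨-, h⟩ | ⟨h, -⟩) <;> exact h
    · intro hvT
      by_cases hv𝓛 : v ∈ 𝓛
      · exact Or.inl ⟨hv𝓛, hvT⟩
      · exact Or.inr ⟨hvT, hv𝓛⟩
  have key : HasDirichletDensity K (𝓛 ∩ T) (c - 0) := by
    refine (hT.sub h0).congr' (Filter.eventually_of_mem self_mem_nhdsWithin fun s hs => ?_)
    beta_reduce
    rw [tsum_indicator_union (X := T) hunion.symm hdisj hs, add_div, add_sub_cancel_right]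
  rw [sub_zero] at key
  exact key

/-- **Removing finitely many places does not change the density.** [folklore] -/
theorem HasDirichletDensity.diff_of_finite {P F : Set (HeightOneSpectrum (𝓞 K))} {d : ℝ}
    (hP : HasDirichletDensity K P d) (hF : F.Finite) : HasDirichletDensity K (P \ F) d := by
  have h1 : HasDirichletDensity K Fᶜ 1 := hasDirichletDensity_one_of_cofinite (by rwa [compl_compl])
  have := h1.inter_of_one hP
  rwa [← Set.sdiff_eq_compl_inter] at this

/-- **A set of positive density is infinite** (finite sets have density `0`, and the density is
unique). [folklore] -/
theorem HasDirichletDensity.infinite_of_pos {T : Set (HeightOneSpectrum (𝓞 K))} {c : ℝ}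
    (hT : HasDirichletDensity K T c) (hc : 0 < c) : T.Infinite := fun hfin =>
  hc.ne' ((hasDirichletDensity_zero_of_finite hfin).unique hT).symm

/-- **A density-one set meets every set of positive density in infinitely many places** — the
form in which "Chebotarev + density one" arguments (Böckle–Hui 2025, Prop. 2.4, Lemma 2.8) pick
places: `𝓛 ∩ T` has density `c > 0`, hence is infinite.
[cite: BockleHui2025, Proposition 2.4 (proof)] -/
theorem HasDirichletDensity.infinite_inter_of_one_of_pos {𝓛 T : Set (HeightOneSpectrum (𝓞 K))}
    {c : ℝ} (h𝓛 : HasDirichletDensity K 𝓛 1) (hT : HasDirichletDensity K T c) (hc : 0 < c) :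
    (𝓛 ∩ T).Infinite :=
  (h𝓛.inter_of_one hT).infinite_of_pos hc

/-- In particular a density-one set meets every set of positive density outside any finite set
of exceptions. [folklore] -/
theorem HasDirichletDensity.exists_mem_inter_not_mem_of_one_of_pos
    {𝓛 T F : Set (HeightOneSpectrum (𝓞 K))} {c : ℝ} (h𝓛 : HasDirichletDensity K 𝓛 1)
    (hT : HasDirichletDensity K T c) (hc : 0 < c) (hF : F.Finite) :
    ∃ v, v ∈ 𝓛 ∧ v ∈ T ∧ v ∉ F := by
  obtain ⟨v, ⟨⟨hv𝓛, hvT⟩, hvF⟩⟩ :=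
    ((h𝓛.infinite_inter_of_one_of_pos hT hc).sdiff hF).nonempty
  exact ⟨v, hv𝓛, hvT, hvF⟩

end NumberField

end Literature.NumberTheory.LFunctions
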